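import Summits.QuantumFields.BalabanUV.T4Continuum.Support.SmoothRefineAbelianEnd
import Summits.QuantumFields.BalabanUV.T4Continuum.Support.SmoothRefineOfApprox
import HarnessLib

/-!
# T⁴ programme, node NE3 — the kinematic refinement lemma, abelian line, file 10: THE OWNER'S SHAPES BY NAME —
# `ApproxRefine … 0`, `SmoothRefine`, and the action η-rate, for `U(1)`-valued configurations (`SmoothRefineAbelianApprox`)

Cell `pub-balaban`, NE3 formalisation swarm (`t4/formal/NE3/LEAVES.md` row S4b, unit
`b2b-balaban-t4-ne3-formalise-leaf-10`); sequel of `SmoothRefineAbelianEnd` (the construction and its properties) and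
of the row owner's `SmoothRefineOfApprox` (t4-ne3-p1 (42S): the R1 shape `ApproxRefine`, the glue
`smoothRefine_of_approxRefine`) and `MinimalActionRefine` ((37S): `RegularSup`, `SmoothRefine`,
`actionRate_sfClass_of_smoothRefine`).  BY-NAME BOOKKEEPING ONLY — for `[Unique n]` (`1 × 1` matrices, `U(1)`):

* `approxRefine_sfClass_abelian` : `ApproxRefine d (sfClass d L N ε) L N b c (b1 d L b c) (c1 d L c) 0` under
  `K0 d L · b ≤ 1` — LEAF R1 IN THE ABELIAN CASE, KERNEL, WITH MISMATCH ZERO;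
* `smoothRefine_sfClass_abelian` : `SmoothRefine d (sfClass d L N ε) L N b c (b1 d L b c) (c1 d L c)` under `K0 d L · b ≤ 1`
  and the class condition `b1 d L b c ≤ ε` — DIRECTLY from the exact construction (no chain-end fix, hence none of the
  fixed point's smallness conditions);
* `actionRate_sfClass_abelian` : NE3's ACTION HALF on the small-field class for `U(1)`, from (H1) ∧ (H3ˢᵘᵖ) ∧ (H0) (B11
  Thm 1 TYPE shapes, hypotheses) ALONE — the kinematic lemma being a THEOREM in the abelian case.

HONEST: the abelian sanity case only (the cell's target is `SU(2)`/`U(N)`, where `ApproxRefine` is OPEN — rows S4c–S4e);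
the constant `b1 = (2b + dcL²) + (2b + dcL²)²` carries `d·c·L²` unsplit, so `b1 ≤ ε` needs `ε ≳ 2b + dcL²` (recorded for
the dictionary seat S3).  HONEST FRAMING: finite-`T⁴` kinematics (rung (B)+1 — NOT infinite volume, NOT a mass gap, NOT
Clay); NE3 NOT proved: NE3-(A) stays CONDITIONAL on ⟨(H1), (H3ˢᵘᵖ), (H0)⟩ and, beyond `U(1)`, on the non-abelian
`ApproxRefine`; no `BetaPertH`, no (B), no G-an2-4; no printed sentence is a hypothesis; spine PROVED 0/9 unchanged.
PLACEMENT (human rule 2026-08-19): our work, under `Summits/QuantumFields/BalabanUV/`.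
-/

set_option autoImplicit false

open scoped BigOperators Matrix Matrix.Norms.L2Operator
open NormedSpace

namespace Summit.QuantumFields.BalabanUV.T4Continuum.SmoothRefineAbelianApprox

open Literature.MathematicalPhysics.QuantumFieldTheory.Balaban1983to89
open B7Prop1Explicit B7Prop2Explicit MatrixLog UnitaryModel
open T4AveragingDeficitWall hiding Site Plane Plaq Bond
open T4AveragingDeficitWallBoundary (IsPeriodicCfg)
open T4AveragingDeficitNonAbelian (wallConstNA)
open T4EtaRateMin (ActionRate)
open MinimalActionSandwich MinimalActionRate MinimalActionRefine SmoothRefineOfApprox SmoothRefineAbelianEnd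

noncomputable section

variable {d : ℕ} {n : Type*} [Fintype n] [DecidableEq n] [Unique n]


/-- **LEAF R1 IN THE ABELIAN CASE, WITH MISMATCH ZERO**: `ApproxRefine d (sfClass d L N ε) L N b c b₁ c₁ 0` for
`U(1)`-valued configurations, `b₁ = b1 d L b c`, `c₁ = c1 d L c`, under `K0 d L · b ≤ 1`. [folklore] -/
theorem approxRefine_sfClass_abelian {L N : ℕ} (hL : 1 ≤ L) {b c ε : ℝ} (hb0 : 0 ≤ b) (hc0 : 0 ≤ c)
    (hb : K0 d L * b ≤ 1) : ApproxRefine d (sfClass (n := n) d L N ε) L N b c (b1 d L b c) (c1 d L c) 0 := by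
  intro j U _ hreg
  exact approxRefine_abelian_mismatch hL hb0 hc0 le_rfl hb hreg.unitary hreg.periodic hreg.small hreg.grad

/-- **THE KINEMATIC LEMMA IN THE ABELIAN CASE**: `SmoothRefine d (sfClass d L N ε) L N b c b₁ c₁` for `U(1)`-valued
configurations, directly from the exact construction (`rescale L (bavg L W) = U`), under `K0 d L · b ≤ 1` and the class
condition `b₁ ≤ ε`. [folklore] -/
theorem smoothRefine_sfClass_abelian {L N : ℕ} (hL : 1 ≤ L) {b c ε : ℝ} (hb0 : 0 ≤ b) (hc0 : 0 ≤ c)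
    (hb : K0 d L * b ≤ 1) (hε : b1 d L b c ≤ ε) : SmoothRefine d (sfClass (n := n) d L N ε) L N b c (b1 d L b c) (c1 d L c) := by
  intro j U _ hreg
  obtain ⟨W, h1, h2, h3, h4, h5⟩ :=
    approxRefine_abelian hL hb0 hc0 hb hreg.unitary hreg.periodic hreg.small hreg.grad
  exact ⟨W, mem_sfClass_of_refined hε h1 h2 h3, h5, ⟨h1, h2, h3, h4⟩⟩

/-- **NE3, ACTION HALF, FOR `U(1)` ON THE SMALL-FIELD CLASS — FROM THE B11-TYPE SHAPES ALONE**: given (H1) existence of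
minimisers, (H3ˢᵘᵖ) their sup-form regularity `(b, c)`, (H0) the sup-form regularity of the data, the minimal actions obey
`ActionRate (minActReadings …) (wallConstNA(d,L)·(gradConst d (max c c₁) + (max b b₁)³)/L²) (L⁻²)` — the kinematic lemma
being discharged by `smoothRefine_sfClass_abelian`.  NE3 is NOT proved (and this is the abelian case only). [folklore] -/
theorem actionRate_sfClass_abelian {L N : ℕ} (hL : 1 ≤ L) (hN : 1 ≤ N) {b c ε : ℝ} (hb0 : 0 ≤ b) (hc0 : 0 ≤ c)
    (hb : K0 d L * b ≤ 1) (hε : b1 d L b c ≤ ε)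
    (hBs : 512 * (d + 1) * (d + 4) * (L : ℝ) ^ 2 * max b (b1 d L b c) ≤ 1)
    (hbε : b + 226 * (8 * (d + 1) * (d + 4)) ^ 2 * b ^ 2 ≤ ε) {dom : Set (Site d → Fin d → (Matrix n n ℂ)ˣ)}
    (h1 : ∀ V ∈ dom, ∀ k : ℕ, ∃ U, IsMinimiser d (sfClass d L N ε) L N k V U)
    (h3 : ∀ V ∈ dom, ∀ (k : ℕ) (U : Site d → Fin d → (Matrix n n ℂ)ˣ),
      IsMinimiser d (sfClass d L N ε) L N (k + 1) V U → RegularSup d L N b c (k + 1) U)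
    (h0 : ∀ V ∈ dom, RegularSup d L N b c 0 V)
    {X : Type*} (loc : ℕ → (Site d → Fin d → (Matrix n n ℂ)ˣ) → X → ℝ) :
    ActionRate (minActReadings d (sfClass d L N ε) L N dom loc)
      (wallConstNA d L * (gradConst d (max c (c1 d L c)) + (max b (b1 d L b c)) ^ 3) / (L : ℝ) ^ 2) (((L : ℝ) ^ 2)⁻¹) :=
  actionRate_sfClass_of_smoothRefine hL hN hb0 hBs hbε h1 h3 h0 (smoothRefine_sfClass_abelian hL hb0 hc0 hb hε) loc

end

end Summit.QuantumFields.BalabanUV.T4Continuum.SmoothRefineAbelianApprox
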